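import Literature.AlgebraicGeometry.Frobenioids.ArithmeticFrobenioidThm64ivCompatCor411
import Literature.AlgebraicGeometry.Frobenioids.ArithmeticFrobenioidDivisorTransport
import HarnessLib

/-!
# Frobenioids I, Theorem 6.4 (iv) — the second clause WITH its `F₁/F₂`-compatibility AT THE DATA, unconditionally
# (for `F₁` Galois over `ℚ`)

Mochizuki, *The geometry of Frobenioids I: the general theory*, Kyushu J. Math. **62** (2008) 293–400, §6, Theorem 6.4
(iv), kurims p. 115 [cite: MochizukiFrdI2008, Thm. 6.4 (iv) p.115]: "… compatible with the isomorphism `L₁ ⥲ L₂` [and the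
natural inclusions `F_i ↪ L_i`]"; Corollary 4.11 (iv) p. 91 [cite: MochizukiFrdI2008, Cor. 4.11 (iv) p.91].

PROOF-ONLY file (cell abc-iut, sub-DAG `plan/L1/SUBDAG-FrdI-Thm64.md` row T64iv/L07b AT THE DATA; seat abc-iut-L1-d4; no
definitions).  Composition BY NAME of
* this seat's `Thm64iv_arith_compat_of_cor411iv` / `nonempty_baseRingEquiv_arith_of_cor411iv`
  (`ArithmeticFrobenioidThm64ivCompatCor411.lean`: the clause modulo the typed Cor. 4.11 (iv) node, via abc-iut-L1-d7's
  `exists_transport_of_cor411iv` and this seat's `Thm64iv_arith_compat_of_isGalois_base`), with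
* the tree's `cor411iv_arith` (`ArithmeticFrobenioidDivisorTransport.lean`: the typed Cor. 4.11 (iv) at THE arithmetic
  Frobenioids for EVERY equivalence, via abc-iut-L1-t14's `FrdI.cor411iv_of_cor411ii_of_isOfFSMType`; abc-iut-f-033's
  `PreFrobenioid.cor411iv_holds_of_isOfFSMType'` gives the same by the FSM-base route),
at `Spec F₁ = ⟨⊥⟩` (`IntermediateField.botEquiv`).  Result: for `F₁` Galois over `ℚ`, EVERY equivalence
`Ψ : C_{K₁/F₁} ⥲ C_{K₂/F₂}` of THE arithmetic Frobenioids lies over an equivalence of base categories along which every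
Galois `L` satisfies the printed clause with its `F₁/F₂`-compatibility (`Thm64iv_arith_compat_unconditional`); in particular
`F₁ ≅ F₂` (`nonempty_baseRingEquiv_of_arithFrobenioid_equivalence`).  The non-Galois-`F₁` case is GAP G-L1t3-1 (abc-iut-w4-d090's
p430249 sharpens it to arithmetic equivalence); abc-iut-L1-d7's staged `ArithmeticFrobenioidThm64ivUnconditional.lean` reaches the
same clause through abc-iut-L1-t14's `cor411iv_ofFunctor_of_isOfFSMType` — either route closes the row.
Nothing here is specific to the abc programme or bears on [IUTchIII] Cor. 3.12; no statement of the paper is strengthened.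
-/

noncomputable section

namespace Literature.AlgebraicGeometry.Frobenioids

open CategoryTheory NumberField

section Unconditional

variable {F₁ : Type} [Field F₁] [NumberField F₁] {K₁ : Type} [Field K₁] [Algebra F₁ K₁] [IsGalois F₁ K₁]
variable {F₂ : Type} [Field F₂] [NumberField F₂] {K₂ : Type} [Field K₂] [Algebra F₂ K₂] [IsGalois F₂ K₂]

/-- **[FrdI] Theorem 6.4 (iv), second clause WITH the `F₁/F₂`-compatibility, AT THE DATA, NO HYPOTHESIS beyond the data**
(for `F₁` Galois over `ℚ`): every equivalence `Ψ : C_{K₁/F₁} ⥲ C_{K₂/F₂}` of THE arithmetic Frobenioids lies over an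
equivalence `Ψ^Base` of the base categories such that for every `Spec L` with `L` Galois there are `L ≅ L_{Ψ^Base(Spec L)}` and
`F₁ ≅ F₂` compatible with the structure maps. [cite: MochizukiFrdI2008, Thm. 6.4 (iv) p.115] -/
theorem Thm64iv_arith_compat_unconditional [IsGalois ℚ F₁] (Ψ : arithFrobenioid F₁ K₁ ≌ arithFrobenioid F₂ K₂) :
    ∃ ΨBase : FinSubextCat F₁ K₁ ⥤ FinSubextCat F₂ K₂, ΨBase.IsEquivalence ∧
      ∀ X : FinSubextCat F₁ K₁, IsGalois ℚ X.L →
        ∃ (e : X.L ≃+* (ΨBase.obj X).L) (e₀ : F₁ ≃+* F₂),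
          ∀ a : F₁, e (algebraMap F₁ X.L a) = algebraMap F₂ (ΨBase.obj X).L (e₀ a) :=
  Thm64iv_arith_compat_of_cor411iv Ψ (cor411iv_arith Ψ) ⟨⊥⟩ (IntermediateField.botEquiv F₁ K₁)

/-- **An equivalence of THE arithmetic Frobenioids forces `F₁ ≅ F₂`** (`F₁` Galois over `ℚ`; no further hypothesis).
[cite: MochizukiFrdI2008, Thm. 6.4 (iv) p.115] -/
theorem nonempty_baseRingEquiv_of_arithFrobenioid_equivalence [IsGalois ℚ F₁]
    (Ψ : arithFrobenioid F₁ K₁ ≌ arithFrobenioid F₂ K₂) : Nonempty (F₁ ≃+* F₂) :=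
  nonempty_baseRingEquiv_arith_of_cor411iv Ψ (cor411iv_arith Ψ) ⟨⊥⟩ (IntermediateField.botEquiv F₁ K₁)

end Unconditional

end Literature.AlgebraicGeometry.Frobenioids

end
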